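import Mathlib
import Summits.ValiantsHypothesis.ValiantsHypothesis.Theses.ValuativeGCT
import Summits.ValiantsHypothesis.ValiantsHypothesis.Theorems.ValuativeGCTValuativeBound
import Summits.ValiantsHypothesis.ValiantsHypothesis.Theorems.ValuativeGCTGctMultPrinciple
import Summits.ValiantsHypothesis.ValiantsHypothesis.Theorems.ValuativeGCTNoValuativeFlipBeyondGrenet
import Summits.ValiantsHypothesis.ValiantsHypothesis.Theorems.ValuativeGCTNoValuativeFlipBoundedLength
import Summits.ValiantsHypothesis.ValiantsHypothesis.Theorems.ValuativeGCTNoValuativeFlipReductions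
import Summits.ValiantsHypothesis.ValiantsHypothesis.Theorems.ValuativeGCTNoValuativeFlipResidual
import Summits.ValiantsHypothesis.ValiantsHypothesis.Theorems.ValuativeGCTNoValuativeFlipSharpResidual
import Summits.ValiantsHypothesis.ValiantsHypothesis.Theorems.ValuativeGCTNoValuativeFlipUnconditional
import Literature.Computability.AlgebraicComplexity.OrbitCoordinateRingProofs
import Literature.NumberTheory.DiophantineGeometry.SchurWeylPlethysmCoordRepWeightsProofs
import Literature.NumberTheory.DiophantineGeometry.SchurWeylPlethysmOrbitWeightsProofs

/-!
# Disproof of `TailFlip` (crux stmt-ValiantsHypothesis-15687, route ValuativeGCT) — findings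

Standing adversary file of the crux disprover (refuter, cdisprove mode, cycle 1, 2026-08-16).
Prose lives in docstrings; every `theorem` is sorry-free (there is no `NearMisses` section yet).
The crux (`Theses.ValuativeGCT.TailFlip`, rev 4):
`∀ a b, b < a → ∀ c, ∃ n₀, ∀ n ≥ n₀, ∀ m [NeZero m], a·n < b·m → m ≤ 2^((log₂ n + c)^c) → FlipAt n m`,
where `FlipAt n m` (this file, VERBATIM the crux body, `tailFlip_iff : … := Iff.rfl`) says: some
centre `(U, r)` (all of `U` of rank `≤ r`), degree `δ` and shape `λ ⊢ mδ` (`≤ m²` parts) have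
`dim T_U(λ) < mult_{λ*} ℂ[Δ_m(X₀₀^(m-n) per_n)]`.

VERDICT (cycle 1): the crux SURVIVES every cheap attack and is NOT misstated; it is the honest
superlinear-padding residual of `ValuativeFlip`.  A refutation `¬ TailFlip` needs, for ONE slope,
ONE `c` and INFINITELY MANY `n`, a padding `m` in the tail with NO valuative flip at `(n, m)` for ALL
`(U, r, δ, λ)` — a "no (valuative) multiplicity obstruction" theorem inside a quasi-polynomial
window, which is open (Bürgisser–Ikenmeyer–Panova 2019 kill OCCURRENCE obstructions only, at
`m ≥ n^25`; Bläser–Ikenmeyer 2025 §12.4).  No finite computation can refute it (`∃ n₀`), and every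
fixed-`n` instance is eventually flipless anyway (`not_flipAt_of_two_pow_le`).  Findings:

* **T1 The no-flip engines, in `FlipAt` currency** (`§1`): beyond Grenet `2ⁿ ≤ m + 1`
  (`not_flipAt_of_two_pow_le`; so `n ≤ 2` never flips, `n = 3` only at `m ∈ {4,5,6}`, `n = 4` only at
  `m ≤ 14`: `not_flipAt_zero/one/two/three/four`); bounded length `m ≥ 1 + n(n+1)^ℓ(λ)`
  (`not_flipAtLen_of_le`); outside Kadish–Landsberg (tree); and — NEW packaging for the line —
  evaluation certificates whose points are `End`-points of `det_m` are dominated by EVERY truncation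
  (`certificate_le_finrank_of_endDet`: `D ≤ K_m(λ*) ≤ dim T_U(λ)`), so they can never witness a census
  inequality `dim T_U < D`.
* **T2 Load-bearing clauses** (`§2`, "any proof must use …"): the window TOP (`not_tailFlipWithoutTop`,
  witness `m = 2^n₀ + 2n₀ + 1`); the THRESHOLD `∃ n₀` (`not_tailFlipAllN`, witness `(a,b,c,n,m) =
  (4,3,1,2,3)`; and for every finite slope and every `c` the instance `(n, m) = (0, 1)`:
  `threshold_ne_zero`); the threshold must DEPEND on `c` (`not_tailFlipUniform`) and quantitatively
  `2^((log₂ n + c)^c) + 1 < 2ⁿ` for every `n ≥ n₀(c)` at which the slope admits Grenet's point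
  (`two_pow_windowTop_lt_of_flipsFrom`; slope `2/1`: `(log₂ n + c)^c < n` for all `n ≥ max n₀ 3`,
  `log_add_pow_lt_of_flipsFrom`): for slope `2/1`, `n₀(c) > c^c` (`pow_self_lt_threshold`),
  `n₀(2) ≥ 65` (`threshold_two`), `n₀(3) ≥ 2745` (`threshold_three`).  Inherited from the parent
  (Cruxes/ValuativeFlip/Disproof.lean F4/F5, not re-proved here): the rank bound on `U` is the only
  clause separating the body from triviality; homogeneity clause redundant; `ℓ(λ) ≤ m²` cosmetic;
  `b < a` only excludes the head `m ≤ (a/b)·n` (with `b = a` the statement is `ValuativeFlip` minus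
  its free bottom `m = n`).
* **T3 Natural strengthenings refuted** (`§3`): flips on shapes of BOUNDED LENGTH in the tail are
  impossible — `not_tailFlipLen L` for every `L` (slope 2, window `c = L + 3`, padding
  `m = n^(L+2)`, `noValuativeFlip_body_of_card_parts'`); uniform threshold (`not_tailFlipUniform`).
  So the witnesses' length must tend to infinity along the window: `ℓ(λ) > log_{n+1}((m-1)/n)`
  (`flipAt_witness`), i.e. `ℓ > (log₂ n + c)^c / log₂(n+1) - 1` at the top.
* **T4 Logical position** (`§4`, sorry-free): `ValuativeFlip → TailFlip` (restriction;
  `not_valuativeFlip_of_not_tailFlip`: a kill here kills the parent crux #2 and, by `closes`, the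
  route); `NoValuativeFlip → ¬ TailFlip` (`not_tailFlip_of_noValuativeFlip`: the route's kill
  statement transfers to the child — padding `n^(c₀+2)` sits in the tail of window `c₀ + 3`);
  conversely `TailFlip → ¬ NoValuativeFlip → DcPerSuperpolynomial ℂ`
  (`dcPerSuperpolynomial_of_tailFlip`: proving the crux proves Valiant's hypothesis in dc form), and
  directly `TailFlip → ¬ HasBorderDetRepr ℂ n m` throughout the tail (`tailFlip_border`, by
  `GctMultPrinciple_proof ∘ ValuativeBound_proof`).  What any proof must in particular deliver:
  flips at every polynomial padding `m = n^(c₀+2)` (`flipAt_pow_of_tailFlip`), at the first slope-2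
  cells `(n, 2n+1)` (`flipAt_two_mul_succ_of_tailFlip`) and on the dyadic blocks `((1+1/b)·2^k, 2^(k+1)]`
  of the `c = 1` window (`flipAt_dyadic_of_tailFlip`); slopes `(b+1)/b` suffice (`tailFlip_iff_succSlopes`).
* **T5 Witness constraints in the tail** (`§5`, from the landed no-flip ranges + `ValuativeBound_proof`
  + BIP occurrence transfer): a witness `(U, r, δ, λ)` at a tail position has `m + 1 < 2ⁿ`,
  `δ(m-n) ≤ λ₁` (so `λ₁ > δ·((a-b)/b)·n`), `ℓ(λ) ≤ n² + 1`, `m < 1 + n(n+1)^ℓ(λ)` (`flipAt_witness`),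
  and for `m ≥ n^25` the weight occurs on BOTH sides, `0 < K_m(λ*) ≤ dim T_U(λ)` (`flipAt_witness_occurs`):
  in the polynomial part of the tail a flip is a genuine MULTIPLICITY (not occurrence) obstruction
  against a nonzero truncation.
* **T6 Why it resists** (no theorem): (i) `¬ TailFlip` quantifies over infinitely many `n`; (ii) at a
  fixed `(n, m)` in the tail, "no flip for all `(U, r, δ, λ)`" needs `mult_pp(λ*) ≤ dim T_U(λ)` for the
  SMALLEST truncations, i.e. (parent F6: the cut is invisible on the null cone, so only Edmonds-gap
  centres matter) lower bounds for `dim T_Λ` on Kadish–Landsberg shapes of growing length at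
  `n < m < 2ⁿ - 1` — no engine exists (those of T1 are all there is, and none covers a full fibre
  `{all λ}` at any tail point); (iii) the cheapest conceivable counterexample cell is `(n, m) = (3, 4)`
  (`16` variables, quartics, all `δ`), already beyond exact census (the refuters' censuses stop at
  `(m, δ) = (5, 6)` on ≤ 5-row shapes, and bounded rows provably do not decide: T3); (iv) sandwich
  `sk-flip on the tail ⇒ TailFlip ⇒ GctMultFlip on the tail ⇒ DcPerSuperpolynomial`: both ends open.
  Literature checked this cycle: arXiv:1604.06431 (BIP19, Thm 1.4 occurrence only), arXiv:1512.03798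
  (IP17, Kronecker positivity `m > 3n⁴` — bounds the `U = ⊥` majorant `sk`, says nothing below it),
  arXiv:1911.03990 / arXiv:1901.04576 (pro-multiplicity toy separations), doi:10.4086/toc.gs.2025.010
  §12.4 (multiplicity no-go open); negatives index of the summit (4 entries) untouched.
* **Line `Sketch` (isobaric anchors, PICKED 2026-08-16)** (`§6`): the lead's stubs 1–2 are engines
  (provable now) and stub 3 `stub_isobaricTailCensus` is a STRENGTHENING of the crux (it implies
  `TailFlip` by `TailFlip_of`), so nothing here can be weaker than T6 for it; recorded constraints on
  its witnesses: by `certificate_le_finrank_of_endDet`, the padded anchors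
  `X₀₀^j · x_t^i · (A_l · per_K)` must NOT all be `End`-points of `det_{K+i+j}` — with Grenet's block
  (`dc(per_K) ≤ 2^K - 1`, block-diagonal with `x_t·I_i` and `X₀₀`-homogenisation) they ARE as soon as
  `j ≥ 2^K - 1 - K`, so anchors need `2^K > j + K + 1`, i.e. `K > log₂ j` (`≈ (log₂ N + c)^c` at the top
  of the window, still `≤ N`: consistent, no kill); by T3/T5 the anchor shape needs `ℓ(μ) → ∞` with
  the window and body `|μ̄| = Kδ - μ₁ > m` (mixed-discriminant card / StableRay), hence `δ > m/K`.
  No stuck stubs were handed to this seat (payload `stuck_stubs = []`).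

LANDED from this file (all ACCEPTED @ 7b96f1ca095d, `--supports stmt-ValiantsHypothesis-15687`; import
them rather than this workfile):
`Theorems/TailFlip/Negative/TailFlipLoadBearing.lean` (p117803: §0–§2, `FlipAt`, mutations, thresholds,
must-deliver cells), `…/TailFlipBoundedLength.lean` (p117808: §3), `…/TailFlipKillTransfer.lean`
(p117794: §4–§5), `…/TailFlipCertificateInsideDet.lean` (p117810: the certificate lemmas of §1);
namespace `Summit.ValiantsHypothesis.ValiantsHypothesis.Theorems.TailFlip.Negative`.

Prior work used: refuter-rattack one-shot note on the item (2026-08-16T16:21Z, evidence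
TailFlipAttack.lean, A1–A8: re-derived here as `tailFlip_iff`, `not_tailFlipAllN`,
`not_tailFlipWithoutTop`, `flipAt_dyadic_of_tailFlip`, `not_tailFlip_of_noValuativeFlip`); parent
disproof Cruxes/ValuativeFlip/Disproof.lean F1–F7 (cited, not imported); tree
`Theorems/ValuativeGCTNoValuativeFlip{BeyondGrenet,BoundedLength,Residual,SharpResidual,Unconditional}`,
`ValuativeBound_proof`, `GctMultPrinciple_proof`, the certificate bridge of `Theorems/ValuativeGCTValuativeFlipCertificateBridge` (restated).
-/

set_option linter.dupNamespace false

namespace Summit.ValiantsHypothesis.ValiantsHypothesis.Cruxes.TailFlip.Disproof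

open Literature.NumberTheory.DiophantineGeometry Literature.Computability.AlgebraicComplexity
open Summit.ValiantsHypothesis.ValiantsHypothesis.Theses.ValuativeGCT
open Summit.ValiantsHypothesis.ValiantsHypothesis.Theorems.NoValuativeFlip
open Summit.ValiantsHypothesis.ValiantsHypothesis.Theorems.ValuativeBound

/-! ## §0 Names for the pieces of the crux -/

/-- `FlipAt n m`: the flip body of the crux at inner size `n` and determinant size `m`, VERBATIM
(some centre `(U, r)`, degree `δ`, shape `λ ⊢ mδ` with `≤ m²` parts, `dim T_U(λ) < mult_pp(λ*)`). -/
def FlipAt (n m : ℕ) [NeZero m] : Prop :=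
  ∃ (U : Submodule ℂ (Literature.NumberTheory.DiophantineGeometry.MatIdx m → ℂ)) (r δ : ℕ) (lam : Nat.Partition (m * δ)), (∀ u ∈ U, (Matrix.of fun a b : Fin m => u (toLex (a, b))).rank ≤ r) ∧ lam.parts.card ≤ m * m ∧ (let χ : Literature.NumberTheory.DiophantineGeometry.Weight (Literature.NumberTheory.DiophantineGeometry.MatIdx m) := (Literature.NumberTheory.DiophantineGeometry.Weight.dualOfPartition (m * m) lam).toMatIdx; let T : Submodule ℂ (MvPolynomial (Literature.NumberTheory.DiophantineGeometry.MatIdx m × Literature.NumberTheory.DiophantineGeometry.MatIdx m) ℂ) := MvPolynomial.homogeneousSubmodule (Literature.NumberTheory.DiophantineGeometry.MatIdx m × Literature.NumberTheory.DiophantineGeometry.MatIdx m) ℂ (m * δ) ⊓ ((MvPolynomial.vanishingIdeal ℂ {p : Literature.NumberTheory.DiophantineGeometry.MatIdx m × Literature.NumberTheory.DiophantineGeometry.MatIdx m → ℂ | ∀ j : Literature.NumberTheory.DiophantineGeometry.MatIdx m, (fun i => p (j, i)) ∈ U}) ^ (δ * (m - r))).restrictScalars ℂ ⊓ (⨅ (M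 : Matrix (Literature.NumberTheory.DiophantineGeometry.MatIdx m) (Literature.NumberTheory.DiophantineGeometry.MatIdx m) ℂ) (_ : Literature.Computability.AlgebraicComplexity.linSubst (Literature.NumberTheory.DiophantineGeometry.MatIdx m) ℂ M (Literature.NumberTheory.DiophantineGeometry.detFormLex ℂ m) = Literature.NumberTheory.DiophantineGeometry.detFormLex ℂ m), LinearMap.ker ((MvPolynomial.aeval (R := ℂ) fun p : Literature.NumberTheory.DiophantineGeometry.MatIdx m × Literature.NumberTheory.DiophantineGeometry.MatIdx m => ∑ l : Literature.NumberTheory.DiophantineGeometry.MatIdx m, M l p.2 • MvPolynomial.X (p.1, l)).toLinearMap - LinearMap.id (R := ℂ) (M := MvPolynomial (Literature.NumberTheory.DiophantineGeometry.MatIdx m × Literature.NumberTheory.DiophantineGeometry.MatIdx m) ℂ))) ⊓ (⨅ (g : Matrix.GeneralLinearGroup (Literature.NumberTheory.DiophantineGeometry.MatIdx m) ℂ) (_ : Literature.NumberTheory.DiophantineGeometry.IsUpperTriangular g), LinearMap.ker ((MvPolynomial.aeval (R := ℂ) fun p : Literature.NumberTheory.DiophantineGeometry.MatIdx m × Literature.NumberTheory.DiophantineGeometry.MatIdx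 m => ∑ l : Literature.NumberTheory.DiophantineGeometry.MatIdx m, ((g⁻¹ : Matrix.GeneralLinearGroup (Literature.NumberTheory.DiophantineGeometry.MatIdx m) ℂ) : Matrix (Literature.NumberTheory.DiophantineGeometry.MatIdx m) (Literature.NumberTheory.DiophantineGeometry.MatIdx m) ℂ) p.1 l • MvPolynomial.X (l, p.2)).toLinearMap - Literature.NumberTheory.DiophantineGeometry.weightChar χ g • LinearMap.id (R := ℂ) (M := MvPolynomial (Literature.NumberTheory.DiophantineGeometry.MatIdx m × Literature.NumberTheory.DiophantineGeometry.MatIdx m) ℂ))); Module.finrank ℂ ↥T < Literature.NumberTheory.DiophantineGeometry.orbitMultiplicity ℂ (Literature.NumberTheory.DiophantineGeometry.paddedPerFormLex ℂ n m) m χ)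

/-- `FlipAtLen n m L`: the flip body with the EXTRA constraint `ℓ(λ) ≤ L` on the witness shape
(a natural strengthening: flips on shapes of bounded length). -/
def FlipAtLen (n m L : ℕ) [NeZero m] : Prop :=
  ∃ (U : Submodule ℂ (Literature.NumberTheory.DiophantineGeometry.MatIdx m → ℂ)) (r δ : ℕ) (lam : Nat.Partition (m * δ)), (∀ u ∈ U, (Matrix.of fun a b : Fin m => u (toLex (a, b))).rank ≤ r) ∧ lam.parts.card ≤ m * m ∧ lam.parts.card ≤ L ∧ (let χ : Literature.NumberTheory.DiophantineGeometry.Weight (Literature.NumberTheory.DiophantineGeometry.MatIdx m) := (Literature.NumberTheory.DiophantineGeometry.Weight.dualOfPartition (m * m) lam).toMatIdx; let T : Submodule ℂ (MvPolynomial (Literature.NumberTheory.DiophantineGeometry.MatIdx m × Literature.NumberTheory.DiophantineGeometry.MatIdx m) ℂ) := MvPolynomial.homogeneousSubmodule (Literature.NumberTheory.DiophantineGeometry.MatIdx m × Literature.NumberTheory.DiophantineGeometry.MatIdx m) ℂ (m * δ) ⊓ ((MvPolynomial.vanishingIdeal ℂ {p : Literature.NumberTheory.DiophantineGeometry.MatIdx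 m × Literature.NumberTheory.DiophantineGeometry.MatIdx m → ℂ | ∀ j : Literature.NumberTheory.DiophantineGeometry.MatIdx m, (fun i => p (j, i)) ∈ U}) ^ (δ * (m - r))).restrictScalars ℂ ⊓ (⨅ (M : Matrix (Literature.NumberTheory.DiophantineGeometry.MatIdx m) (Literature.NumberTheory.DiophantineGeometry.MatIdx m) ℂ) (_ : Literature.Computability.AlgebraicComplexity.linSubst (Literature.NumberTheory.DiophantineGeometry.MatIdx m) ℂ M (Literature.NumberTheory.DiophantineGeometry.detFormLex ℂ m) = Literature.NumberTheory.DiophantineGeometry.detFormLex ℂ m), LinearMap.ker ((MvPolynomial.aeval (R := ℂ) fun p : Literature.NumberTheory.DiophantineGeometry.MatIdx m × Literature.NumberTheory.DiophantineGeometry.MatIdx m => ∑ l : Literature.NumberTheory.DiophantineGeometry.MatIdx m, M l p.2 • MvPolynomial.X (p.1, l)).toLinearMap - LinearMap.id (R := ℂ) (M := MvPolynomial (Literature.NumberTheory.DiophantineGeometry.MatIdx m × Literature.NumberTheory.DiophantineGeometry.MatIdx m) ℂ))) ⊓ (⨅ (g : Matrix.GeneralLinearGroup (Literature.NumberTheory.DiophantineGeometry.MatIdx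 m) ℂ) (_ : Literature.NumberTheory.DiophantineGeometry.IsUpperTriangular g), LinearMap.ker ((MvPolynomial.aeval (R := ℂ) fun p : Literature.NumberTheory.DiophantineGeometry.MatIdx m × Literature.NumberTheory.DiophantineGeometry.MatIdx m => ∑ l : Literature.NumberTheory.DiophantineGeometry.MatIdx m, ((g⁻¹ : Matrix.GeneralLinearGroup (Literature.NumberTheory.DiophantineGeometry.MatIdx m) ℂ) : Matrix (Literature.NumberTheory.DiophantineGeometry.MatIdx m) (Literature.NumberTheory.DiophantineGeometry.MatIdx m) ℂ) p.1 l • MvPolynomial.X (l, p.2)).toLinearMap - Literature.NumberTheory.DiophantineGeometry.weightChar χ g • LinearMap.id (R := ℂ) (M := MvPolynomial (Literature.NumberTheory.DiophantineGeometry.MatIdx m × Literature.NumberTheory.DiophantineGeometry.MatIdx m) ℂ))); Module.finrank ℂ ↥T < Literature.NumberTheory.DiophantineGeometry.orbitMultiplicity ℂ (Literature.NumberTheory.DiophantineGeometry.paddedPerFormLex ℂ n m) m χ)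

/-- The crux is literally `∀ slope > 1, ∀ c, eventually in n, ∀ m in the tail window, FlipAt n m`. -/
theorem tailFlip_iff :
    TailFlip ↔ ∀ a b : ℕ, b < a → ∀ c : ℕ, ∃ n₀ : ℕ, ∀ n ≥ n₀, ∀ (m : ℕ) [NeZero m],
      a * n < b * m → m ≤ 2 ^ ((Nat.log 2 n + c) ^ c) → FlipAt n m :=
  Iff.rfl

/-- A bounded-length flip is a flip. -/
theorem flipAt_of_flipAtLen {n m L : ℕ} [NeZero m] (h : FlipAtLen n m L) : FlipAt n m := by
  obtain ⟨U, r, δ, lam, hU, hcard, -, hlt⟩ := h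
  exact ⟨U, r, δ, lam, hU, hcard, hlt⟩

/-- **Normal form of the slope quantifier**: the slopes `(b+1)/b`, `b ≥ 1`, suffice — the tail of
a slope `a/b > 1` (`a ≥ b + 1`) is contained in the tail of `(b+1)/b`, and `b = 0` is vacuous. -/
theorem tailFlip_iff_succSlopes :
    TailFlip ↔ ∀ b : ℕ, 0 < b → ∀ c : ℕ, ∃ n₀ : ℕ, ∀ n ≥ n₀, ∀ (m : ℕ) [NeZero m],
      (b + 1) * n < b * m → m ≤ 2 ^ ((Nat.log 2 n + c) ^ c) → FlipAt n m := by
  constructor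
  · intro h b _ c
    exact h (b + 1) b (Nat.lt_succ_self b) c
  · intro h a b hba c
    rcases Nat.eq_zero_or_pos b with rfl | hb
    · exact ⟨0, fun n _ m _ hlt _ => absurd hlt (by simp)⟩
    · obtain ⟨n₀, hn₀⟩ := h b hb c
      refine ⟨n₀, fun n hn m _ hlt hm => hn₀ n hn m ?_ hm⟩
      have : (b + 1) * n ≤ a * n := Nat.mul_le_mul_right n hba
      omega

/-! ## §1 The no-flip engines in `FlipAt` currency -/

/-- **No flip beyond Grenet's bound** `2ⁿ ≤ m + 1`: there `X₀₀^(m-n) per_n ∈ Δ(det_m)` (Grenet 2011 +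
Mulmuley–Sohoni 2001 Prop. 4.4), so `mult_pp(λ*) ≤ K_m(λ*) ≤ dim T_U(λ)` for every centre
(`noValuativeFlip_body_of_two_pow_le'`, with `ValuativeBound_proof`). -/
theorem not_flipAt_of_two_pow_le {n m : ℕ} [NeZero m] (hm : 2 ^ n ≤ m + 1) : ¬ FlipAt n m := by
  rintro ⟨U, r, δ, lam, hU, hcard, hlt⟩
  exact (not_le.mpr hlt) (noValuativeFlip_body_of_two_pow_le' m hm U r hU δ lam hcard)

/-- `n = 0` (`per_0 = 1`, `pp = X₀₀^m`) never flips. -/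
theorem not_flipAt_zero (m : ℕ) [NeZero m] : ¬ FlipAt 0 m :=
  not_flipAt_of_two_pow_le (by rw [pow_zero]; exact Nat.le_add_left 1 m)

/-- `n = 1` (`per_1 = x`, `pp = X₀₀^(m-1) x`) never flips. -/
theorem not_flipAt_one (m : ℕ) [NeZero m] : ¬ FlipAt 1 m :=
  not_flipAt_of_two_pow_le (by rw [pow_one]; exact Nat.succ_le_succ NeZero.one_le)

/-- `n = 2` (`per_2 ≅ det_2`) never flips in the tail (`m ≥ 3`). -/
theorem not_flipAt_two {m : ℕ} [NeZero m] (hm : 3 ≤ m) : ¬ FlipAt 2 m :=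
  not_flipAt_of_two_pow_le (by norm_num; omega)

/-- `n = 3`: no flip at `m ≥ 7 = dc(per_3)`; the only conceivable tail cells are `m ∈ {4, 5, 6}`. -/
theorem not_flipAt_three {m : ℕ} [NeZero m] (hm : 7 ≤ m) : ¬ FlipAt 3 m :=
  not_flipAt_of_two_pow_le (by norm_num; omega)

/-- `n = 4`: no flip at `m ≥ 15`; conceivable tail cells `m ∈ {5, …, 14}`. -/
theorem not_flipAt_four {m : ℕ} [NeZero m] (hm : 15 ≤ m) : ¬ FlipAt 4 m :=
  not_flipAt_of_two_pow_le (by norm_num; omega)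

/-- **No bounded-length flip in the inheritance range** `m ≥ 1 + n (n+1)^L`: support transfer +
sized Valiant universality put `mult_pp(λ*) ≤ K_m(λ*)` for `ℓ(λ) ≤ L`
(`noValuativeFlip_body_of_card_parts'`). -/
theorem not_flipAtLen_of_le {n m L : ℕ} [NeZero m] (hm : 1 + n * (n + 1) ^ L ≤ m) :
    ¬ FlipAtLen n m L := by
  rintro ⟨U, r, δ, lam, hU, hcard, hlen, hlt⟩
  have hm' : 1 + n * (n + 1) ^ lam.parts.card ≤ m :=
    le_trans (Nat.add_le_add_left
      (Nat.mul_le_mul_left n (Nat.pow_le_pow_right (Nat.succ_pos n) hlen)) 1) hm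
  exact (not_le.mpr hlt) (noValuativeFlip_body_of_card_parts' m U r hU δ lam hcard hm')

/-- An element of `I(GL · f)` vanishes at `B · f` for EVERY matrix `B` (singular allowed):
`I(GL · f)` is the kernel of the generic orbit map (`orbitVanishingIdeal_eq_ker_genericOrbitMap`,
`aeval_genericOrbitMap`; `GL` is Zariski dense in `Mat`). [folklore] -/
theorem aeval_formCoeff_eq_zero_of_mem_orbitVanishingIdeal {m N : ℕ} (f : MvPolynomial (MatIdx m) ℂ)
    {G : MvPolynomial (DegIdx (MatIdx m) N) ℂ} (hG : G ∈ orbitVanishingIdeal f N)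
    (B : Matrix (MatIdx m) (MatIdx m) ℂ) :
    MvPolynomial.aeval (formCoeff N (linSubst (MatIdx m) ℂ B f)) G = 0 := by
  rw [orbitVanishingIdeal_eq_ker_genericOrbitMap, RingHom.mem_ker] at hG
  have h1 := aeval_genericOrbitMap f N G B
  rw [hG, map_zero] at h1
  exact h1.symm

/-- **Certificate bridge** (= `ValuativeFlip.le_orbitMultiplicity_of_det_ne_zero` of
`Theorems/ValuativeGCTValuativeFlipCertificateBridge`, restated over Literature lemmas only because
that module is not built on the farm at the time of writing): highest-weight vectors `F₁ … F_D` of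
weight `χ` in `ℂ[Sym^N ℂ^σ]` with a NONSINGULAR evaluation matrix at points `p_l` of the zero locus of
`I(GL · f)` give `D ≤ orbitMultiplicity ℂ f N χ` (`N ≠ 0`). [folklore] -/
theorem le_orbitMultiplicity_of_det_ne_zero' {m N : ℕ} (hN : N ≠ 0) (f : MvPolynomial (MatIdx m) ℂ)
    (χ : Weight (MatIdx m)) {D : ℕ} (F : Fin D → MvPolynomial (DegIdx (MatIdx m) N) ℂ)
    (hF : ∀ i, F i ∈ highestWeightSpace (coordRep (MatIdx m) ℂ N) χ)
    (p : Fin D → (DegIdx (MatIdx m) N → ℂ))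
    (hp : ∀ j, ∀ G ∈ orbitVanishingIdeal f N, MvPolynomial.aeval (p j) G = 0)
    (hdet : (Matrix.of fun i j : Fin D => MvPolynomial.aeval (p j) (F i)).det ≠ 0) :
    D ≤ orbitMultiplicity ℂ f N χ := by
  classical
  haveI := finiteDimensional_highestWeightSpace_orbitCoordRep_holds (k := ℂ) f hN χ
  have hM : LinearIndependent ℂ (fun i : Fin D => fun j : Fin D => MvPolynomial.aeval (p j) (F i)) :=
    Matrix.linearIndependent_rows_of_det_ne_zero hdet
  have hli : LinearIndependent ℂ
      (fun i => Ideal.Quotient.mkₐ ℂ (orbitVanishingIdeal f N) (F i)) := by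
    rw [Fintype.linearIndependent_iff] at hM ⊢
    intro c hc i
    refine hM c ?_ i
    have hmem : ∑ i, c i • F i ∈ orbitVanishingIdeal f N := by
      rw [← Ideal.Quotient.eq_zero_iff_mem, ← Ideal.Quotient.mkₐ_eq_mk ℂ, map_sum]
      simpa only [map_smul] using hc
    funext j
    have h0 := hp j _ hmem
    rw [map_sum] at h0
    simp only [map_smul, smul_eq_mul] at h0
    simpa only [Finset.sum_apply, Pi.smul_apply, smul_eq_mul, Pi.zero_apply] using h0
  set W := highestWeightSpace (orbitCoordRep f N) χ with hW
  let y : Fin D → W := fun i =>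
    ⟨Ideal.Quotient.mkₐ ℂ (orbitVanishingIdeal f N) (F i),
      mk_mem_highestWeightSpace_orbitCoordRep f (hF i)⟩
  have hy : LinearIndependent ℂ y := LinearIndependent.of_comp W.subtype hli
  have h := hy.fintype_card_le_finrank
  rw [Fintype.card_fin] at h
  unfold orbitMultiplicity hwMultiplicity
  exact h

/-- **Certificates anchored inside `Δ(det_m)` certify nothing against the census** (for the line
`Sketch`, stub `stub_isobaricTailCensus`).  Let `F₁ … F_D` be highest-weight vectors of weight `λ*`
in `ℂ[Sym^m ℂ^{m²}]` and `p₁ … p_D` points of the orbit CLOSURE `Δ(det_m)` (zeros of `I(GL · det_m)`).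
If the evaluation matrix `(F_i(p_l))` is nonsingular then `D ≤ dim T_U(λ)` for EVERY admissible centre
`(U, r)`: `D ≤ K_m(λ*)` by the certificate bridge at `f = det_m`, and `K_m(λ*) ≤ dim T_U(λ)` is
`ValuativeBound_proof`.  So a census witness `dim T_U(λ) < D` with an evaluation certificate forces
some evaluation point OUTSIDE `Δ(det_m)`. -/
theorem certificate_le_finrank_of_mem_orbitClosure (m : ℕ) [NeZero m] {δ : ℕ}
    (lam : Nat.Partition (m * δ)) (hcard : lam.parts.card ≤ m * m)
    (D : ℕ) (F : Fin D → MvPolynomial (DegIdx (MatIdx m) m) ℂ)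
    (hF : ∀ i, F i ∈ highestWeightSpace (coordRep (MatIdx m) ℂ m)
      ((Weight.dualOfPartition (m * m) lam).toMatIdx : Weight (MatIdx m)))
    (p : Fin D → (DegIdx (MatIdx m) m → ℂ))
    (hp : ∀ l, ∀ G ∈ orbitVanishingIdeal (detFormLex ℂ m) m, MvPolynomial.aeval (p l) G = 0)
    (hdet : (Matrix.of fun i l : Fin D => MvPolynomial.aeval (p l) (F i)).det ≠ 0)
    (U : Submodule ℂ (MatIdx m → ℂ)) (r : ℕ)
    (hU : ∀ u ∈ U, (Matrix.of fun a b : Fin m => u (toLex (a, b))).rank ≤ r) :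
    let χ : Literature.NumberTheory.DiophantineGeometry.Weight (Literature.NumberTheory.DiophantineGeometry.MatIdx m) := (Literature.NumberTheory.DiophantineGeometry.Weight.dualOfPartition (m * m) lam).toMatIdx; let T : Submodule ℂ (MvPolynomial (Literature.NumberTheory.DiophantineGeometry.MatIdx m × Literature.NumberTheory.DiophantineGeometry.MatIdx m) ℂ) := MvPolynomial.homogeneousSubmodule (Literature.NumberTheory.DiophantineGeometry.MatIdx m × Literature.NumberTheory.DiophantineGeometry.MatIdx m) ℂ (m * δ) ⊓ ((MvPolynomial.vanishingIdeal ℂ {p : Literature.NumberTheory.DiophantineGeometry.MatIdx m × Literature.NumberTheory.DiophantineGeometry.MatIdx m → ℂ | ∀ j : Literature.NumberTheory.DiophantineGeometry.MatIdx m, (fun i => p (j, i)) ∈ U}) ^ (δ * (m - r))).restrictScalars ℂ ⊓ (⨅ (M : Matrix (Literature.NumberTheory.DiophantineGeometry.MatIdx m) (Literature.NumberTheory.DiophantineGeometry.MatIdx m) ℂ) (_ : Literature.Computability.AlgebraicComplexity.linSubst (Literature.NumberTheory.DiophantineGeometry.MatIdx m) ℂ M (Literature.NumberTheory.DiophantineGeometry.detFormLex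 ℂ m) = Literature.NumberTheory.DiophantineGeometry.detFormLex ℂ m), LinearMap.ker ((MvPolynomial.aeval (R := ℂ) fun p : Literature.NumberTheory.DiophantineGeometry.MatIdx m × Literature.NumberTheory.DiophantineGeometry.MatIdx m => ∑ l : Literature.NumberTheory.DiophantineGeometry.MatIdx m, M l p.2 • MvPolynomial.X (p.1, l)).toLinearMap - LinearMap.id (R := ℂ) (M := MvPolynomial (Literature.NumberTheory.DiophantineGeometry.MatIdx m × Literature.NumberTheory.DiophantineGeometry.MatIdx m) ℂ))) ⊓ (⨅ (g : Matrix.GeneralLinearGroup (Literature.NumberTheory.DiophantineGeometry.MatIdx m) ℂ) (_ : Literature.NumberTheory.DiophantineGeometry.IsUpperTriangular g), LinearMap.ker ((MvPolynomial.aeval (R := ℂ) fun p : Literature.NumberTheory.DiophantineGeometry.MatIdx m × Literature.NumberTheory.DiophantineGeometry.MatIdx m => ∑ l : Literature.NumberTheory.DiophantineGeometry.MatIdx m, ((g⁻¹ : Matrix.GeneralLinearGroup (Literature.NumberTheory.DiophantineGeometry.MatIdx m) ℂ) : Matrix (Literature.NumberTheory.DiophantineGeometry.MatIdx m) (Literature.NumberTheory.DiophantineGeometry.MatIdx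 m) ℂ) p.1 l • MvPolynomial.X (l, p.2)).toLinearMap - Literature.NumberTheory.DiophantineGeometry.weightChar χ g • LinearMap.id (R := ℂ) (M := MvPolynomial (Literature.NumberTheory.DiophantineGeometry.MatIdx m × Literature.NumberTheory.DiophantineGeometry.MatIdx m) ℂ))); D ≤ Module.finrank ℂ ↥T := by
  intro χ T
  exact (le_orbitMultiplicity_of_det_ne_zero' (NeZero.ne m) (detFormLex ℂ m) χ F hF p hp hdet).trans
    (ValuativeBound_proof m U r hU δ lam hcard)

/-- **In particular for anchors in `End · det_m`**: if the evaluation points are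
`q_l = A_l · (X₀₀^(m-n) per_n)` AND ALSO `End`-points of the determinant, `q_l = B_l · det_m`
(e.g. they have affine determinantal expressions of size `≤ m`, homogenised), then a nonsingular
evaluation matrix gives `D ≤ dim T_U(λ)` for every admissible centre.  For the isobaric anchors
`X₀₀^j x_t^i (A · per_K)` of the picked line this happens as soon as `j ≥ dc(x_t^i · A·per_K) - K - i`,
in particular (Grenet block ⊕ `x_t I_i`, `dc(per_K) ≤ 2^K - 1`) as soon as `j ≥ 2^K - 1 - K`: a
census witness needs anchors of size `K > log₂ (j + K + 1)`. -/
theorem certificate_le_finrank_of_endDet {n : ℕ} (m : ℕ) [NeZero m] {δ : ℕ}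
    (lam : Nat.Partition (m * δ)) (hcard : lam.parts.card ≤ m * m)
    (D : ℕ) (F : Fin D → MvPolynomial (DegIdx (MatIdx m) m) ℂ)
    (hF : ∀ i, F i ∈ highestWeightSpace (coordRep (MatIdx m) ℂ m)
      ((Weight.dualOfPartition (m * m) lam).toMatIdx : Weight (MatIdx m)))
    (A B : Fin D → Matrix (MatIdx m) (MatIdx m) ℂ)
    (hAB : ∀ l, linSubst (MatIdx m) ℂ (A l) (paddedPerFormLex ℂ n m) =
      linSubst (MatIdx m) ℂ (B l) (detFormLex ℂ m))
    (hdet : (Matrix.of fun i l : Fin D => MvPolynomial.aeval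
      (formCoeff m (linSubst (MatIdx m) ℂ (A l) (paddedPerFormLex ℂ n m))) (F i)).det ≠ 0)
    (U : Submodule ℂ (MatIdx m → ℂ)) (r : ℕ)
    (hU : ∀ u ∈ U, (Matrix.of fun a b : Fin m => u (toLex (a, b))).rank ≤ r) :
    let χ : Literature.NumberTheory.DiophantineGeometry.Weight (Literature.NumberTheory.DiophantineGeometry.MatIdx m) := (Literature.NumberTheory.DiophantineGeometry.Weight.dualOfPartition (m * m) lam).toMatIdx; let T : Submodule ℂ (MvPolynomial (Literature.NumberTheory.DiophantineGeometry.MatIdx m × Literature.NumberTheory.DiophantineGeometry.MatIdx m) ℂ) := MvPolynomial.homogeneousSubmodule (Literature.NumberTheory.DiophantineGeometry.MatIdx m × Literature.NumberTheory.DiophantineGeometry.MatIdx m) ℂ (m * δ) ⊓ ((MvPolynomial.vanishingIdeal ℂ {p : Literature.NumberTheory.DiophantineGeometry.MatIdx m × Literature.NumberTheory.DiophantineGeometry.MatIdx m → ℂ | ∀ j : Literature.NumberTheory.DiophantineGeometry.MatIdx m, (fun i => p (j, i)) ∈ U}) ^ (δ * (m - r))).restrictScalars ℂ ⊓ (⨅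 (M : Matrix (Literature.NumberTheory.DiophantineGeometry.MatIdx m) (Literature.NumberTheory.DiophantineGeometry.MatIdx m) ℂ) (_ : Literature.Computability.AlgebraicComplexity.linSubst (Literature.NumberTheory.DiophantineGeometry.MatIdx m) ℂ M (Literature.NumberTheory.DiophantineGeometry.detFormLex ℂ m) = Literature.NumberTheory.DiophantineGeometry.detFormLex ℂ m), LinearMap.ker ((MvPolynomial.aeval (R := ℂ) fun p : Literature.NumberTheory.DiophantineGeometry.MatIdx m × Literature.NumberTheory.DiophantineGeometry.MatIdx m => ∑ l : Literature.NumberTheory.DiophantineGeometry.MatIdx m, M l p.2 • MvPolynomial.X (p.1, l)).toLinearMap - LinearMap.id (R := ℂ) (M := MvPolynomial (Literature.NumberTheory.DiophantineGeometry.MatIdx m × Literature.NumberTheory.DiophantineGeometry.MatIdx m) ℂ))) ⊓ (⨅ (g : Matrix.GeneralLinearGroup (Literature.NumberTheory.DiophantineGeometry.MatIdx m) ℂ) (_ : Literature.NumberTheory.DiophantineGeometry.IsUpperTriangular g), LinearMap.ker ((MvPolynomial.aeval (R := ℂ) fun p : Literature.NumberTheory.DiophantineGeometry.MatIdx m ×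 Literature.NumberTheory.DiophantineGeometry.MatIdx m => ∑ l : Literature.NumberTheory.DiophantineGeometry.MatIdx m, ((g⁻¹ : Matrix.GeneralLinearGroup (Literature.NumberTheory.DiophantineGeometry.MatIdx m) ℂ) : Matrix (Literature.NumberTheory.DiophantineGeometry.MatIdx m) (Literature.NumberTheory.DiophantineGeometry.MatIdx m) ℂ) p.1 l • MvPolynomial.X (l, p.2)).toLinearMap - Literature.NumberTheory.DiophantineGeometry.weightChar χ g • LinearMap.id (R := ℂ) (M := MvPolynomial (Literature.NumberTheory.DiophantineGeometry.MatIdx m × Literature.NumberTheory.DiophantineGeometry.MatIdx m) ℂ))); D ≤ Module.finrank ℂ ↥T := by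
  have hdet' : (Matrix.of fun i l : Fin D => MvPolynomial.aeval
      (formCoeff m (linSubst (MatIdx m) ℂ (B l) (detFormLex ℂ m))) (F i)).det ≠ 0 := by
    simpa only [hAB] using hdet
  exact certificate_le_finrank_of_mem_orbitClosure m lam hcard D F hF
    (fun l => formCoeff m (linSubst (MatIdx m) ℂ (B l) (detFormLex ℂ m)))
    (fun l G hG => aeval_formCoeff_eq_zero_of_mem_orbitVanishingIdeal (detFormLex ℂ m) hG (B l))
    hdet' U r hU

/-! ## §2 Load-bearing clauses of the crux (any proof must use …) -/

/-- The crux with the window's TOP `m ≤ 2^((log₂ n + c)^c)` deleted (then `c` is idle and dropped). -/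
def TailFlipWithoutTop : Prop :=
  ∀ a b : ℕ, b < a → ∃ n₀ : ℕ, ∀ n ≥ n₀, ∀ (m : ℕ) [NeZero m], a * n < b * m → FlipAt n m

/-- **Any proof must use the window top**: without it the tail contains Grenet's range; witness
slope `2/1`, `n = n₀`, `m = 2^n₀ + 2n₀ + 1`. -/
theorem not_tailFlipWithoutTop : ¬ TailFlipWithoutTop := by
  intro h
  obtain ⟨n₀, hn₀⟩ := h 2 1 one_lt_two
  haveI : NeZero (2 ^ n₀ + 2 * n₀ + 1) := ⟨Nat.succ_ne_zero _⟩
  have h1 : 1 ≤ 2 ^ n₀ := Nat.one_le_two_pow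
  exact not_flipAt_of_two_pow_le (n := n₀) (m := 2 ^ n₀ + 2 * n₀ + 1) (by omega)
    (hn₀ n₀ le_rfl (2 ^ n₀ + 2 * n₀ + 1) (by omega))

/-- The crux with the threshold `∃ n₀, ∀ n ≥ n₀` replaced by `∀ n`. -/
def TailFlipAllN : Prop :=
  ∀ a b : ℕ, b < a → ∀ c n : ℕ, ∀ (m : ℕ) [NeZero m],
    a * n < b * m → m ≤ 2 ^ ((Nat.log 2 n + c) ^ c) → FlipAt n m

/-- `Nat.log 2 2 = 1`. [folklore] -/
theorem log_two_two : Nat.log 2 2 = 1 :=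
  Nat.log_eq_of_pow_le_of_lt_pow (by norm_num) (by norm_num)

/-- **Any proof must use the threshold**: `(a, b, c, n, m) = (4, 3, 1, 2, 3)` is a tail instance
(`4·2 < 3·3`, `3 ≤ 2^((log₂ 2 + 1)^1) = 4`) with a genuine permanent (`per_2`) and no flip
(`2² ≤ 3 + 1`, Grenet/`per_2 = det_2`). -/
theorem not_tailFlipAllN : ¬ TailFlipAllN := fun h =>
  not_flipAt_two (m := 3) le_rfl
    (h 4 3 (by norm_num) 1 2 3 (by norm_num) (by rw [log_two_two]; norm_num))

/-- **The threshold is at least `1` for every finite slope and every `c`**: `(n, m) = (0, 1)` is in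
every tail (`a·0 < b·1`, `1 ≤ 2^(…)`) and never flips. -/
theorem threshold_ne_zero {a b c n₀ : ℕ} (hb : 0 < b)
    (h : ∀ n ≥ n₀, ∀ (m : ℕ) [NeZero m], a * n < b * m → m ≤ 2 ^ ((Nat.log 2 n + c) ^ c) → FlipAt n m) :
    n₀ ≠ 0 := by
  rintro rfl
  exact not_flipAt_zero 1 (h 0 le_rfl 1 (by simpa using hb) Nat.one_le_two_pow)

/-- **From the threshold on, the window top is below Grenet's bound** wherever the slope admits
Grenet's point: if the crux body holds at `(a, b, c)` from `n₀` on, then for every `n ≥ n₀` with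
`a·n < b·(2ⁿ - 1)` one has `2^((log₂ n + c)^c) + 1 < 2ⁿ` (else `m = 2ⁿ - 1` is a tail position with
no flip).  So every proof's threshold `n₀(a, b, c)` lies beyond the last `n` with
`(log₂ n + c)^c ≥ n` (roughly `n₀(c) > (c log₂ c)^c`). -/
theorem two_pow_windowTop_lt_of_flipsFrom {a b c n₀ : ℕ}
    (h : ∀ n ≥ n₀, ∀ (m : ℕ) [NeZero m], a * n < b * m → m ≤ 2 ^ ((Nat.log 2 n + c) ^ c) → FlipAt n m)
    {n : ℕ} (hn : n₀ ≤ n) (hslope : a * n < b * (2 ^ n - 1)) :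
    2 ^ ((Nat.log 2 n + c) ^ c) + 1 < 2 ^ n := by
  by_contra hle
  rw [not_lt] at hle
  have hpos : 0 < 2 ^ n - 1 := by
    rcases Nat.eq_zero_or_pos (2 ^ n - 1) with h0 | h0
    · rw [h0, mul_zero] at hslope
      exact absurd hslope (Nat.not_lt_zero _)
    · exact h0
  haveI : NeZero (2 ^ n - 1) := NeZero.of_pos hpos
  have h1 : 1 ≤ 2 ^ n := Nat.one_le_two_pow
  refine not_flipAt_of_two_pow_le (n := n) (m := 2 ^ n - 1) (by omega) (h n hn (2 ^ n - 1) hslope ?_)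
  omega

/-- `2n + 2 ≤ 2ⁿ` for `n ≥ 3`. [folklore] -/
theorem two_mul_add_two_le_two_pow {n : ℕ} (hn : 3 ≤ n) : 2 * n + 2 ≤ 2 ^ n := by
  induction n, hn using Nat.le_induction with
  | base => norm_num
  | succ k hk ih => rw [pow_succ]; omega

/-- The crux with a threshold UNIFORM in `c` (`∃ n₀, ∀ c` instead of `∀ c, ∃ n₀`). -/
def TailFlipUniform : Prop :=
  ∀ a b : ℕ, b < a → ∃ n₀ : ℕ, ∀ c : ℕ, ∀ n ≥ n₀, ∀ (m : ℕ) [NeZero m],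
    a * n < b * m → m ≤ 2 ^ ((Nat.log 2 n + c) ^ c) → FlipAt n m

/-- **The threshold must depend on `c`** (natural strengthening refuted): with `c = n` the window at
`n` reaches `2^((log₂ n + n)^n) ≥ 2ⁿ`, i.e. contains Grenet's point. -/
theorem not_tailFlipUniform : ¬ TailFlipUniform := by
  intro h
  obtain ⟨n₀, hn₀⟩ := h 2 1 one_lt_two
  set n : ℕ := max n₀ 3 with hn
  have hn0 : n₀ ≤ n := le_max_left _ _
  have hn3 : 3 ≤ n := le_max_right _ _
  have h2n := two_mul_add_two_le_two_pow hn3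
  have hlt := two_pow_windowTop_lt_of_flipsFrom (hn₀ n) hn0 (by omega)
  have hge : 2 ^ n ≤ 2 ^ ((Nat.log 2 n + n) ^ n) :=
    Nat.pow_le_pow_right two_pos
      ((Nat.le_add_left n (Nat.log 2 n)).trans (Nat.le_self_pow (by omega) _))
  omega

/-- **Quantitative threshold, slope `2/1`**: for `c ≥ 2`, any threshold of the crux body at
`(a, b) = (2, 1)` exceeds `c^c` (at `n = c^c`, `(log₂ n + c)^c ≥ c^c = n`, so the window contains
Grenet's point `2ⁿ - 1 > 2n`). -/
theorem pow_self_lt_threshold {c n₀ : ℕ} (hc : 2 ≤ c)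
    (h : ∀ n ≥ n₀, ∀ (m : ℕ) [NeZero m], 2 * n < 1 * m → m ≤ 2 ^ ((Nat.log 2 n + c) ^ c) → FlipAt n m) :
    c ^ c < n₀ := by
  by_contra hle
  rw [not_lt] at hle
  have hc3 : 3 ≤ c ^ c :=
    calc 3 ≤ 2 ^ 2 := by norm_num
      _ ≤ c ^ 2 := Nat.pow_le_pow_left hc 2
      _ ≤ c ^ c := Nat.pow_le_pow_right (by omega) hc
  have h2n := two_mul_add_two_le_two_pow hc3
  have hlt := two_pow_windowTop_lt_of_flipsFrom h hle (by omega)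
  have hge : 2 ^ (c ^ c) ≤ 2 ^ ((Nat.log 2 (c ^ c) + c) ^ c) :=
    Nat.pow_le_pow_right two_pos (Nat.pow_le_pow_left (Nat.le_add_left c _) c)
  omega

/-- **The threshold lies beyond the fixed point of `(log₂ n + c)^c = n`** (slope `2/1`): if the
crux body holds at `(2, 1, c)` from `n₀` on, then `(log₂ n + c)^c < n` for every `n ≥ max n₀ 3` —
otherwise the window at `n` reaches `2ⁿ > 2ⁿ - 1 ≥ 2n + 1`, Grenet's flipless point. -/
theorem log_add_pow_lt_of_flipsFrom {c n₀ : ℕ}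
    (h : ∀ n ≥ n₀, ∀ (m : ℕ) [NeZero m], 2 * n < 1 * m → m ≤ 2 ^ ((Nat.log 2 n + c) ^ c) → FlipAt n m)
    {n : ℕ} (hn : n₀ ≤ n) (hn3 : 3 ≤ n) : (Nat.log 2 n + c) ^ c < n := by
  by_contra hle
  rw [not_lt] at hle
  have h2n := two_mul_add_two_le_two_pow hn3
  have hlt := two_pow_windowTop_lt_of_flipsFrom h hn (by omega)
  have hge : 2 ^ n ≤ 2 ^ ((Nat.log 2 n + c) ^ c) := Nat.pow_le_pow_right two_pos hle
  omega

/-- **`n₀(2) ≥ 65`** for slope `2/1`: `n = 64` has `(log₂ 64 + 2)^2 = 64`, window top `2^64 ≥ 2^64 - 1`. -/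
theorem threshold_two {n₀ : ℕ}
    (h : ∀ n ≥ n₀, ∀ (m : ℕ) [NeZero m], 2 * n < 1 * m → m ≤ 2 ^ ((Nat.log 2 n + 2) ^ 2) → FlipAt n m) :
    64 < n₀ := by
  by_contra hle
  rw [not_lt] at hle
  have hlog : Nat.log 2 64 = 6 := Nat.log_eq_of_pow_le_of_lt_pow (by norm_num) (by norm_num)
  have hlt := two_pow_windowTop_lt_of_flipsFrom h hle (by norm_num)
  rw [hlog] at hlt
  norm_num at hlt

/-- **`n₀(3) ≥ 2745`** for slope `2/1`: `n = 2744 = 14³` has `log₂ 2744 = 11`, `(11 + 3)^3 = 2744`. -/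
theorem threshold_three {n₀ : ℕ}
    (h : ∀ n ≥ n₀, ∀ (m : ℕ) [NeZero m], 2 * n < 1 * m → m ≤ 2 ^ ((Nat.log 2 n + 3) ^ 3) → FlipAt n m) :
    2744 < n₀ := by
  by_contra hle
  rw [not_lt] at hle
  have hlog : Nat.log 2 2744 = 11 := Nat.log_eq_of_pow_le_of_lt_pow (by norm_num) (by norm_num)
  have h2n := two_mul_add_two_le_two_pow (show 3 ≤ 2744 by norm_num)
  have hlt := two_pow_windowTop_lt_of_flipsFrom h hle (by omega)
  rw [hlog] at hlt
  have h14 : 2 ^ ((11 + 3) ^ 3) = 2 ^ 2744 := by norm_num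
  omega

/-! ## §3 Natural strengthenings refuted -/

/-- The crux with witnesses of BOUNDED LENGTH `ℓ(λ) ≤ L`. -/
def TailFlipLen (L : ℕ) : Prop :=
  ∀ a b : ℕ, b < a → ∀ c : ℕ, ∃ n₀ : ℕ, ∀ n ≥ n₀, ∀ (m : ℕ) [NeZero m],
    a * n < b * m → m ≤ 2 ^ ((Nat.log 2 n + c) ^ c) → FlipAtLen n m L

/-- **No proof can use shapes of bounded length**: `TailFlipLen L` is false for every `L`.  Slope
`2/1`, window `c = L + 3`, `n = max n₀ (2^L + 3)`, padding `m = n^(L+2)` (in the tail: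
`2n < n² ≤ m ≤ 2^((log₂ n + L + 3)^(L+3))`, `pow_succ_le_two_pow_log_add_pow`), where
`1 + n(n+1)^L ≤ m` (`one_add_mul_succ_pow_le_pow`) and `not_flipAtLen_of_le` applies.  Hence along
any window the witnesses' length is unbounded: `ℓ(λ) > log_{n+1}((m - 1)/n)`. -/
theorem not_tailFlipLen (L : ℕ) : ¬ TailFlipLen L := by
  intro h
  obtain ⟨n₀, hn₀⟩ := h 2 1 one_lt_two (L + 3)
  set n : ℕ := max n₀ (2 ^ L + 3) with hn
  have hn0 : n₀ ≤ n := le_max_left _ _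
  have hnL : 2 ^ L + 3 ≤ n := le_max_right _ _
  have hL1 : 1 ≤ 2 ^ L := Nat.one_le_two_pow
  have hn3 : 3 ≤ n := by omega
  haveI : NeZero (n ^ (L + 2)) := ⟨pow_ne_zero _ (by omega)⟩
  have hwin : n ^ (L + 2) ≤ 2 ^ ((Nat.log 2 n + (L + 3)) ^ (L + 3)) :=
    pow_succ_le_two_pow_log_add_pow n (L + 1)
  have hsq : n * n ≤ n ^ (L + 2) := by
    rw [← pow_two]
    exact Nat.pow_le_pow_right (by omega) (by omega)
  have htail : 2 * n < 1 * n ^ (L + 2) := by nlinarith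
  have hI : 1 + n * (n + 1) ^ L ≤ n ^ (L + 2) := one_add_mul_succ_pow_le_pow (by omega)
  exact not_flipAtLen_of_le hI (hn₀ n hn0 (n ^ (L + 2)) htail hwin)

/-! ## §4 Logical position of the crux (sorry-free) -/

/-- `b < a` and `a·n < b·m` force `n < m`. [folklore] -/
theorem lt_of_slope {a b n m : ℕ} (hba : b < a) (h : a * n < b * m) : n < m := by
  by_contra hge
  rw [not_lt] at hge
  have h1 : b * m ≤ b * n := Nat.mul_le_mul_left b hge
  have h2 : b * n ≤ a * n := Nat.mul_le_mul_right n hba.le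
  omega

/-- **`ValuativeFlip → TailFlip`** (the crux is the parent's restriction to the tail; = glue item
`ValuativeFlipToTail`, stmt-15805, recorded here only to make the next theorem self-contained). -/
theorem tailFlip_of_valuativeFlip (h : ValuativeFlip) : TailFlip := by
  intro a b hba c
  obtain ⟨n₀, hn₀⟩ := h c
  exact ⟨n₀, fun n hn m _ hlt hm => hn₀ n hn m (lt_of_slope hba hlt).le hm⟩

/-- **A kill here kills the parent**: `¬ TailFlip → ¬ ValuativeFlip` (and then `closes` has a
refuted binder: the route's kill criterion "TailFlip refuted ⇒ handle as refuted:ValuativeFlip"). -/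
theorem not_valuativeFlip_of_not_tailFlip (h : ¬ TailFlip) : ¬ ValuativeFlip :=
  fun hV => h (tailFlip_of_valuativeFlip hV)

/-- **What any proof must deliver, I: flips at every polynomial padding.**  `TailFlip` (slope `2/1`,
window `c₀ + 3`) gives, eventually in `n`, a flip at `m = n^(c₀+2)`. -/
theorem flipAt_pow_of_tailFlip (h : TailFlip) (c₀ : ℕ) :
    ∃ n₀ : ℕ, ∀ n ≥ n₀, ∃ _ : NeZero (n ^ (c₀ + 2)), FlipAt n (n ^ (c₀ + 2)) := by
  obtain ⟨n₁, hn₁⟩ := h 2 1 one_lt_two (c₀ + 3)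
  refine ⟨max n₁ 3, fun n hn => ?_⟩
  have hn1 : n₁ ≤ n := le_of_max_le_left hn
  have hn3 : 3 ≤ n := le_of_max_le_right hn
  haveI hz : NeZero (n ^ (c₀ + 2)) := ⟨pow_ne_zero _ (by omega)⟩
  have hwin : n ^ (c₀ + 2) ≤ 2 ^ ((Nat.log 2 n + (c₀ + 3)) ^ (c₀ + 3)) :=
    pow_succ_le_two_pow_log_add_pow n (c₀ + 1)
  have hsq : n * n ≤ n ^ (c₀ + 2) := by
    rw [← pow_two]
    exact Nat.pow_le_pow_right (by omega) (by omega)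
  have htail : 2 * n < 1 * n ^ (c₀ + 2) := by nlinarith
  exact ⟨hz, hn₁ n hn1 (n ^ (c₀ + 2)) htail hwin⟩

/-- **What any proof must deliver, I′: the cells `(n, 2n + 1)`.**  Slope `2/1`, window `c = 2`
(`2n + 1 ≤ 4n ≤ 2^(log₂ n + 2) ≤ 2^((log₂ n + 2)^2)`): eventually in `n` there is a flip at `m = 2n + 1`,
the first cell of the slope-2 tail. -/
theorem flipAt_two_mul_succ_of_tailFlip (h : TailFlip) :
    ∃ n₀ : ℕ, ∀ n ≥ n₀, FlipAt n (2 * n + 1) := by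
  obtain ⟨n₁, hn₁⟩ := h 2 1 one_lt_two 2
  refine ⟨n₁, fun n hn => hn₁ n hn (2 * n + 1) (by omega) ?_⟩
  have hlt : n < 2 ^ (Nat.log 2 n + 1) := Nat.lt_pow_succ_log_self one_lt_two n
  have h1 : 2 * n + 1 ≤ 2 ^ (Nat.log 2 n + 2) := by
    rw [show Nat.log 2 n + 2 = (Nat.log 2 n + 1) + 1 from rfl, pow_succ]
    omega
  exact h1.trans (Nat.pow_le_pow_right two_pos (Nat.le_self_pow two_ne_zero _))

/-- **What any proof must deliver, II: the dyadic blocks of the `c = 1` window.**  For slope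
`(b+1)/b` and `c = 1`, at `n = 2^k` the window top is `2^(k+1) = 2n`, so `TailFlip` gives, for all
large `k`, a flip at EVERY `m` with `(b+1)·2^k < b·m ≤ b·2^(k+1)` — e.g. `m = 2n` at `n = 2^k`
(slope `< 2`), the "ratio-2 cells" `(4, 8), (8, 16), …` eventually. -/
theorem flipAt_dyadic_of_tailFlip (h : TailFlip) (b : ℕ) :
    ∃ k₀ : ℕ, ∀ k ≥ k₀, ∀ (m : ℕ) [NeZero m], (b + 1) * 2 ^ k < b * m → m ≤ 2 ^ (k + 1) →
      FlipAt (2 ^ k) m := by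
  obtain ⟨n₀, hn₀⟩ := h (b + 1) b (Nat.lt_succ_self b) 1
  refine ⟨n₀, fun k hk m _ hlt hm => hn₀ (2 ^ k) ?_ m hlt ?_⟩
  · exact hk.trans (Nat.lt_two_pow_self).le
  · rwa [Nat.log_pow one_lt_two, pow_one]

/-- **Kill statement transfers to the child**: `NoValuativeFlip → ¬ TailFlip` (exponent `c₀`,
threshold `n₀` of the no-go against the flip at padding `n^(c₀+2) ≥ n^c₀` from
`flipAt_pow_of_tailFlip`).  So REFUTING the crux is implied by — and, inside the window, amounts
to — the open valuative multiplicity no-go (stmt-12629; Bläser–Ikenmeyer 2025 §12.4). -/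
theorem not_tailFlip_of_noValuativeFlip (hno : NoValuativeFlip) : ¬ TailFlip := by
  intro h
  obtain ⟨c₀, n₀, hS⟩ := hno
  obtain ⟨n₁, hn₁⟩ := flipAt_pow_of_tailFlip h c₀
  set n : ℕ := max (max n₀ n₁) 1 with hn
  have hn0 : n₀ ≤ n := (le_max_left _ _).trans (le_max_left _ _)
  have hn1 : n₁ ≤ n := (le_max_right _ _).trans (le_max_left _ _)
  have hnpos : 1 ≤ n := le_max_right _ _
  obtain ⟨hz, hflip⟩ := hn₁ n hn1
  haveI := hz
  have hpad : n ^ c₀ ≤ n ^ (c₀ + 2) := Nat.pow_le_pow_right hnpos (by omega)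
  obtain ⟨U, r, δ, lam, hU, hcard, hlt⟩ := hflip
  exact (not_le.mpr hlt) (hS n hn0 (n ^ (c₀ + 2)) hpad U r hU δ lam hcard)

/-- Contrapositive: **`TailFlip → ¬ NoValuativeFlip`** (proving the crux refutes the route's kill
statement stmt-12629). -/
theorem not_noValuativeFlip_of_tailFlip (h : TailFlip) : ¬ NoValuativeFlip :=
  fun hno => not_tailFlip_of_noValuativeFlip hno h

/-- **`TailFlip → DcPerSuperpolynomial ℂ`**: proving the crux proves Valiant's hypothesis in
determinantal-complexity form (Landsberg 2017 Conj. 1.2.4.2), via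
`dcPerSuperpolynomial_of_not_noValuativeFlip'`.  The crux is thus at least Valiant-hard, as intended. -/
theorem dcPerSuperpolynomial_of_tailFlip (h : TailFlip) : DcPerSuperpolynomial ℂ :=
  dcPerSuperpolynomial_of_not_noValuativeFlip' (not_noValuativeFlip_of_tailFlip h)

/-- **A flip is a border obstruction**: `FlipAt n m → X₀₀^(m-n) per_n ∉ \overline{GL_{m²} · det_m}`
(`n ≤ m`), by `ValuativeBound_proof` (`K_m ≤ dim T_U`) and the multiplicity-obstruction principle
`GctMultPrinciple_proof` (stmt-0889). -/
theorem not_hasBorderDetRepr_of_flipAt {n m : ℕ} [NeZero m] (hnm : n ≤ m) (h : FlipAt n m) :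
    ¬ HasBorderDetRepr ℂ n m := by
  obtain ⟨U, r, δ, lam, hU, hcard, hlt⟩ := h
  exact Summit.ValiantsHypothesis.ValiantsHypothesis.Theorems.GctMultPrinciple_proof n m _ hnm
    (lt_of_le_of_lt (ValuativeBound_proof m U r hU δ lam hcard) hlt)

/-- **`TailFlip` in border-complexity currency**: eventually in `n`, NO position of the tail window
carries a border determinantal expression of the padded permanent. (With border-padding
monotonicity — Mulmuley–Sohoni 2001 §4, not yet a tree fact — this alone is the antecedent of
`GctToVH`, i.e. the crux carries the route's full summit strength without `HeadFlip`.) -/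
theorem tailFlip_border (h : TailFlip) :
    ∀ a b : ℕ, b < a → ∀ c : ℕ, ∃ n₀ : ℕ, ∀ n ≥ n₀, ∀ (m : ℕ) [NeZero m],
      a * n < b * m → m ≤ 2 ^ ((Nat.log 2 n + c) ^ c) → ¬ HasBorderDetRepr ℂ n m := by
  intro a b hba c
  obtain ⟨n₀, hn₀⟩ := h a b hba c
  exact ⟨n₀, fun n hn m _ hlt hm =>
    not_hasBorderDetRepr_of_flipAt (lt_of_slope hba hlt).le (hn₀ n hn m hlt hm)⟩

/-! ## §5 Constraints on witnesses in the tail -/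

/-- **Shape constraints on a tail witness** (landed no-flip ranges, contrapositive;
`valuativeFlip_witness_constraints` with `ValuativeBound_proof`): at a tail position (`b < a`,
`a·n < b·m`) a witness `(U, r, δ, λ)` has `m + 1 < 2ⁿ`, `δ(m-n) ≤ λ₁`, `ℓ(λ) ≤ n² + 1` and
`m < 1 + n(n+1)^ℓ(λ)` — Kadish–Landsberg shapes whose length grows like `log m / log n`. -/
theorem flipAt_witness {a b n : ℕ} (m : ℕ) [NeZero m] (hba : b < a) (htail : a * n < b * m)
    (U : Submodule ℂ (MatIdx m → ℂ)) (r : ℕ)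
    (hU : ∀ u ∈ U, (Matrix.of fun a b : Fin m => u (toLex (a, b))).rank ≤ r)
    (δ : ℕ) (lam : Nat.Partition (m * δ)) (hcard : lam.parts.card ≤ m * m)
    (hflip : (let χ : Literature.NumberTheory.DiophantineGeometry.Weight (Literature.NumberTheory.DiophantineGeometry.MatIdx m) := (Literature.NumberTheory.DiophantineGeometry.Weight.dualOfPartition (m * m) lam).toMatIdx; let T : Submodule ℂ (MvPolynomial (Literature.NumberTheory.DiophantineGeometry.MatIdx m × Literature.NumberTheory.DiophantineGeometry.MatIdx m) ℂ) := MvPolynomial.homogeneousSubmodule (Literature.NumberTheory.DiophantineGeometry.MatIdx m × Literature.NumberTheory.DiophantineGeometry.MatIdx m) ℂ (m * δ) ⊓ ((MvPolynomial.vanishingIdeal ℂ {p : Literature.NumberTheory.DiophantineGeometry.MatIdx m × Literature.NumberTheory.DiophantineGeometry.MatIdx m → ℂ | ∀ j : Literature.NumberTheory.DiophantineGeometry.MatIdx m, (fun i => p (j, i)) ∈ U}) ^ (δ * (m - r))).restrictScalars ℂ ⊓ (⨅ (M : Matrix (Literature.NumberTheory.DiophantineGeometry.MatIdx m) (Literature.NumberTheory.DiophantineGeometry.MatIdx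 m) ℂ) (_ : Literature.Computability.AlgebraicComplexity.linSubst (Literature.NumberTheory.DiophantineGeometry.MatIdx m) ℂ M (Literature.NumberTheory.DiophantineGeometry.detFormLex ℂ m) = Literature.NumberTheory.DiophantineGeometry.detFormLex ℂ m), LinearMap.ker ((MvPolynomial.aeval (R := ℂ) fun p : Literature.NumberTheory.DiophantineGeometry.MatIdx m × Literature.NumberTheory.DiophantineGeometry.MatIdx m => ∑ l : Literature.NumberTheory.DiophantineGeometry.MatIdx m, M l p.2 • MvPolynomial.X (p.1, l)).toLinearMap - LinearMap.id (R := ℂ) (M := MvPolynomial (Literature.NumberTheory.DiophantineGeometry.MatIdx m × Literature.NumberTheory.DiophantineGeometry.MatIdx m) ℂ))) ⊓ (⨅ (g : Matrix.GeneralLinearGroup (Literature.NumberTheory.DiophantineGeometry.MatIdx m) ℂ) (_ : Literature.NumberTheory.DiophantineGeometry.IsUpperTriangular g), LinearMap.ker ((MvPolynomial.aeval (R := ℂ) fun p : Literature.NumberTheory.DiophantineGeometry.MatIdx m × Literature.NumberTheory.DiophantineGeometry.MatIdx m => ∑ l : Literature.NumberTheory.DiophantineGeometry.MatIdx m, ((g⁻¹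 : Matrix.GeneralLinearGroup (Literature.NumberTheory.DiophantineGeometry.MatIdx m) ℂ) : Matrix (Literature.NumberTheory.DiophantineGeometry.MatIdx m) (Literature.NumberTheory.DiophantineGeometry.MatIdx m) ℂ) p.1 l • MvPolynomial.X (l, p.2)).toLinearMap - Literature.NumberTheory.DiophantineGeometry.weightChar χ g • LinearMap.id (R := ℂ) (M := MvPolynomial (Literature.NumberTheory.DiophantineGeometry.MatIdx m × Literature.NumberTheory.DiophantineGeometry.MatIdx m) ℂ))); Module.finrank ℂ ↥T < Literature.NumberTheory.DiophantineGeometry.orbitMultiplicity ℂ (Literature.NumberTheory.DiophantineGeometry.paddedPerFormLex ℂ n m) m χ)) :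
    m + 1 < 2 ^ n ∧ δ * (m - n) ≤ lam.parts.sup ∧ lam.parts.card ≤ n ^ 2 + 1 ∧
      m < 1 + n * (n + 1) ^ lam.parts.card :=
  valuativeFlip_witness_constraints ValuativeBound_proof m (lt_of_slope hba htail).le U r hU δ lam
    hcard hflip

/-- **In the polynomial part of the tail a witness occurs on both sides** (`0 < n`, `n^25 ≤ m`;
Bürgisser–Ikenmeyer–Panova 2019 Thm 1.4 via `valuativeFlip_witness_occurs`): `0 < K_m(λ*)` and
`0 < dim T_U(λ)` — the flip is a genuine multiplicity obstruction against a nonzero truncation. -/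
theorem flipAt_witness_occurs {n : ℕ} (m : ℕ) [NeZero m] (hn : 0 < n) (hnm : n ^ 25 ≤ m)
    (U : Submodule ℂ (MatIdx m → ℂ)) (r : ℕ)
    (hU : ∀ u ∈ U, (Matrix.of fun a b : Fin m => u (toLex (a, b))).rank ≤ r)
    (δ : ℕ) (lam : Nat.Partition (m * δ)) (hcard : lam.parts.card ≤ m * m)
    (hflip : (let χ : Literature.NumberTheory.DiophantineGeometry.Weight (Literature.NumberTheory.DiophantineGeometry.MatIdx m) := (Literature.NumberTheory.DiophantineGeometry.Weight.dualOfPartition (m * m) lam).toMatIdx; let T : Submodule ℂ (MvPolynomial (Literature.NumberTheory.DiophantineGeometry.MatIdx m × Literature.NumberTheory.DiophantineGeometry.MatIdx m) ℂ) := MvPolynomial.homogeneousSubmodule (Literature.NumberTheory.DiophantineGeometry.MatIdx m × Literature.NumberTheory.DiophantineGeometry.MatIdx m) ℂ (m * δ) ⊓ ((MvPolynomial.vanishingIdeal ℂ {p : Literature.NumberTheory.DiophantineGeometry.MatIdx m × Literature.NumberTheory.DiophantineGeometry.MatIdx m → ℂ | ∀ j : Literature.NumberTheory.DiophantineGeometry.MatIdx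 m, (fun i => p (j, i)) ∈ U}) ^ (δ * (m - r))).restrictScalars ℂ ⊓ (⨅ (M : Matrix (Literature.NumberTheory.DiophantineGeometry.MatIdx m) (Literature.NumberTheory.DiophantineGeometry.MatIdx m) ℂ) (_ : Literature.Computability.AlgebraicComplexity.linSubst (Literature.NumberTheory.DiophantineGeometry.MatIdx m) ℂ M (Literature.NumberTheory.DiophantineGeometry.detFormLex ℂ m) = Literature.NumberTheory.DiophantineGeometry.detFormLex ℂ m), LinearMap.ker ((MvPolynomial.aeval (R := ℂ) fun p : Literature.NumberTheory.DiophantineGeometry.MatIdx m × Literature.NumberTheory.DiophantineGeometry.MatIdx m => ∑ l : Literature.NumberTheory.DiophantineGeometry.MatIdx m, M l p.2 • MvPolynomial.X (p.1, l)).toLinearMap - LinearMap.id (R := ℂ) (M := MvPolynomial (Literature.NumberTheory.DiophantineGeometry.MatIdx m × Literature.NumberTheory.DiophantineGeometry.MatIdx m) ℂ))) ⊓ (⨅ (g : Matrix.GeneralLinearGroup (Literature.NumberTheory.DiophantineGeometry.MatIdx m) ℂ) (_ : Literature.NumberTheory.DiophantineGeometry.IsUpperTriangular g), LinearMap.ker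 ((MvPolynomial.aeval (R := ℂ) fun p : Literature.NumberTheory.DiophantineGeometry.MatIdx m × Literature.NumberTheory.DiophantineGeometry.MatIdx m => ∑ l : Literature.NumberTheory.DiophantineGeometry.MatIdx m, ((g⁻¹ : Matrix.GeneralLinearGroup (Literature.NumberTheory.DiophantineGeometry.MatIdx m) ℂ) : Matrix (Literature.NumberTheory.DiophantineGeometry.MatIdx m) (Literature.NumberTheory.DiophantineGeometry.MatIdx m) ℂ) p.1 l • MvPolynomial.X (l, p.2)).toLinearMap - Literature.NumberTheory.DiophantineGeometry.weightChar χ g • LinearMap.id (R := ℂ) (M := MvPolynomial (Literature.NumberTheory.DiophantineGeometry.MatIdx m × Literature.NumberTheory.DiophantineGeometry.MatIdx m) ℂ))); Module.finrank ℂ ↥T < Literature.NumberTheory.DiophantineGeometry.orbitMultiplicity ℂ (Literature.NumberTheory.DiophantineGeometry.paddedPerFormLex ℂ n m) m χ)) :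
    let χ : Literature.NumberTheory.DiophantineGeometry.Weight (Literature.NumberTheory.DiophantineGeometry.MatIdx m) := (Literature.NumberTheory.DiophantineGeometry.Weight.dualOfPartition (m * m) lam).toMatIdx; let T : Submodule ℂ (MvPolynomial (Literature.NumberTheory.DiophantineGeometry.MatIdx m × Literature.NumberTheory.DiophantineGeometry.MatIdx m) ℂ) := MvPolynomial.homogeneousSubmodule (Literature.NumberTheory.DiophantineGeometry.MatIdx m × Literature.NumberTheory.DiophantineGeometry.MatIdx m) ℂ (m * δ) ⊓ ((MvPolynomial.vanishingIdeal ℂ {p : Literature.NumberTheory.DiophantineGeometry.MatIdx m × Literature.NumberTheory.DiophantineGeometry.MatIdx m → ℂ | ∀ j : Literature.NumberTheory.DiophantineGeometry.MatIdx m, (fun i => p (j, i)) ∈ U}) ^ (δ * (m - r))).restrictScalars ℂ ⊓ (⨅ (M : Matrix (Literature.NumberTheory.DiophantineGeometry.MatIdx m) (Literature.NumberTheory.DiophantineGeometry.MatIdx m) ℂ) (_ : Literature.Computability.AlgebraicComplexity.linSubst (Literature.NumberTheory.DiophantineGeometry.MatIdx m) ℂ M (Literature.NumberTheory.DiophantineGeometry.detFormLex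 ℂ m) = Literature.NumberTheory.DiophantineGeometry.detFormLex ℂ m), LinearMap.ker ((MvPolynomial.aeval (R := ℂ) fun p : Literature.NumberTheory.DiophantineGeometry.MatIdx m × Literature.NumberTheory.DiophantineGeometry.MatIdx m => ∑ l : Literature.NumberTheory.DiophantineGeometry.MatIdx m, M l p.2 • MvPolynomial.X (p.1, l)).toLinearMap - LinearMap.id (R := ℂ) (M := MvPolynomial (Literature.NumberTheory.DiophantineGeometry.MatIdx m × Literature.NumberTheory.DiophantineGeometry.MatIdx m) ℂ))) ⊓ (⨅ (g : Matrix.GeneralLinearGroup (Literature.NumberTheory.DiophantineGeometry.MatIdx m) ℂ) (_ : Literature.NumberTheory.DiophantineGeometry.IsUpperTriangular g), LinearMap.ker ((MvPolynomial.aeval (R := ℂ) fun p : Literature.NumberTheory.DiophantineGeometry.MatIdx m × Literature.NumberTheory.DiophantineGeometry.MatIdx m => ∑ l : Literature.NumberTheory.DiophantineGeometry.MatIdx m, ((g⁻¹ : Matrix.GeneralLinearGroup (Literature.NumberTheory.DiophantineGeometry.MatIdx m) ℂ) : Matrix (Literature.NumberTheory.DiophantineGeometry.MatIdx m) (Literature.NumberTheory.DiophantineGeometry.MatIdx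 m) ℂ) p.1 l • MvPolynomial.X (l, p.2)).toLinearMap - Literature.NumberTheory.DiophantineGeometry.weightChar χ g • LinearMap.id (R := ℂ) (M := MvPolynomial (Literature.NumberTheory.DiophantineGeometry.MatIdx m × Literature.NumberTheory.DiophantineGeometry.MatIdx m) ℂ))); 0 < Literature.NumberTheory.DiophantineGeometry.orbitMultiplicity ℂ (Literature.NumberTheory.DiophantineGeometry.detFormLex ℂ m) m χ ∧ 0 < Module.finrank ℂ ↥T :=
  valuativeFlip_witness_occurs m hn hnm U r hU δ lam hcard hflip

/-! ## §6 Line `Sketch` (isobaric anchors) — notes for the lead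

No `-- Targets` yet (payload `targets = []`, `stuck_stubs = []`).  Observations on
`Cruxes/TailFlip/Lines/Sketch.lean` (stubs `stub_isobaricInheritance`, `stub_isobaricSizeLift`
provable now; `stub_isobaricTailCensus` OPEN):

* `stub_isobaricTailCensus → TailFlip` (`TailFlip_of`), so the census stub is at least as strong as
  the crux: every constraint of §5 applies to its witnesses with `λ = (μ♯(K+i))♯m`, `ℓ(λ) = ℓ(μ)`:
  `ℓ(μ)` must be unbounded along the window (§3) although `μ` lives at the anchor size `K`
  (`ℓ(μ) ≤ K²`), so `K → ∞`; `m < 1 + N(N+1)^ℓ(μ)`.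
* By `certificate_le_finrank_of_endDet` the padded anchors must not all be `End · det_m`-points;
  Grenet's block puts `X₀₀^j x_t^i (A·per_K)` inside `End · det_{K+i+j}` once `j ≥ 2^K - 1 - K`, so
  `2^K > j + K + 1`: anchors of size `K ≤ log₂ j` certify nothing (consistent with the card's
  `k ≳ log₂((m-n)/n)`; at the top of window `c`, `K > (log₂ N + c)^c (1 - o(1))`, still `≤ N`).
* Degree: with `NoSmallBodyFlip`-type facts (mixed-discriminant card; landed StableRay for the
  Kronecker majorant) the body `|λ̄| = Kδ - μ₁` must exceed `m`, so `δ > m / K ≥ m / N`.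
* Nothing in this file refutes stub 3; its difficulty is the crux's (T6).
-/

end Summit.ValiantsHypothesis.ValiantsHypothesis.Cruxes.TailFlip.Disproof
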